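import Literature.MathematicalPhysics.QuantumFieldTheory.Balaban1983to89.B14Lem280WardLie
import Literature.Algebra.Lie.CompactKillingForm
import Literature.Algebra.Lie.SpecialUnitarySimple

/-!
# `Balaban1983to89.B14.Lem280WardSuN` — T. Bałaban, *Convergent renormalization expansions for lattice gauge theories*,
# Commun. Math. Phys. **119** (1988) 243–285 [Balaban1988Convergent]: (3.51)/(3.55) for the scalar kernel table of a
# nonabelian gauge-invariant functional (`B14Lem280WardLie`) AT THE LINEAGE'S PRINTED GROUP — compact SIMPLE `G`
# (negative-definite Killing form), in particular `G = SU(N)`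

statement-level skeleton of published theorems with citation tags; proofs where landed; nothing here is a claim about the Yang–Mills mass gap

CITATION HEADER (lean-in-tree rule 2026-08-18).  T. Bałaban, *Convergent renormalization expansions for lattice gauge
theories*, Commun. Math. Phys. **119**, 243–285 (1988), doi:10.1007/BF01217741, bib `Balaban1988Convergent` (cell paper
B14 = "[III]"; PDF held `paper:balaban1988-cmp119-convergent-renormalization`, pp. 280–281 = PDF 38–39: (3.49)–(3.55), the
antisymmetry lemma p. 280 *"We prove the following antisymmetry property …"*).  [I] = [Balaban1987RG1] T. Bałaban, Commun.
Math. Phys. **109** (1987) 249–301, p. 251 (standing hypothesis *"G is semisimple and a Lie subgroup of a group of complex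
unitary matrices, for example G ⊂ U(N)"*), p. 289 after (4.33) (*"With our assumptions on the group G the identity (4.33)
holds for 𝐄 if and only if 𝐄_ab is proportional to the identity matrix"*) — quoted from the module docstrings of
`B12Schur433` / `B14Lem280WardLie` (cell readings).  Lie-algebra inputs: `Literature.Algebra.Lie.CompactKillingForm` (p24,
[Hall2015, §7.1; BrockerTomDieck1985, V (5.13)]: `su n`, `killingForm_su_apply_self_neg`, the instances
`LieAlgebra.IsKilling/IsSemisimple ℝ (su n)`), r20's `B12Schur433.exists_eq_smul_of_centroid_of_killing_neg` (scalar centroid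
of a real SIMPLE Lie algebra with negative-definite Killing form), Mathlib `LieModule.traceForm_lieInvariant`,
`LieAlgebra.IsKilling.killingForm_nondegenerate`, `LieAlgebra.IsSimple.instIsSemisimple`.

WHAT IS REPRODUCED.  SKELETON rows **B14.Lem@280** ((3.51)), **B14.Eq3.55–3.57** ((3.55)) — mega-formalization
`lit-balaban`, HOME `run/shared/lean/pub/lit-balaban/`, unit `lit-balaban-r11` gen 7 (B14 fold owner).  r11 gen 5's
`B14Lem280WardLie.eq355_scalarTable_of_gaugeInvariance` proves (3.51)/(3.55) for the scalar table of a nonabelian invariant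
functional over an ABSTRACT real `𝔤` with the binders `[LieAlgebra.IsSemisimple ℝ 𝔤]`, an invariant nondegenerate form `β`
(`hβ`, `hβn`), the scalar-centroid clause `hcen` (print's «𝐄_ab proportional to the identity» step) and test elements with
`β a l ≠ 0`.  THIS FILE discharges those binders at the printed groups:
* `isKilling_of_killing_neg` — a negative-definite Killing form is non-degenerate (Mathlib `LieAlgebra.IsKilling`).
* `eq355_scalarTable_of_killing_neg` — **COMPACT SIMPLE `G`**: under `[LieAlgebra.IsSimple ℝ 𝔤]` and
  `hdef : ∀ x ≠ 0, κ(x, x) < 0` (the Lie algebra of a compact simple group), (3.51)/(3.55) hold for the scalar table with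
  `β := κ` the Killing form; `[IsSemisimple]` (Mathlib instance from `IsSimple`), `hβ`, `hβn`, `hcen` (`B12Schur433`), `hal`/`hla`
  (any `a ≠ 0`: `κ(a, a) < 0`) DISCHARGED.
* `eq355_scalarTable_su` — **`G = SU(N)`**: `𝔤 := su n` (p24's `CompactKillingForm.su`), `hdef :=
  killingForm_su_apply_self_neg`; the simplicity of `𝔰𝔲(n)` (`|n| ≥ 2`) enters as the typeclass HYPOTHESIS
  `[LieAlgebra.IsSimple ℝ (su n)]` — p24's `Literature/Algebra/Lie/SpecialUnitarySimple` (instance `instIsSimpleSu`, announced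
  HOME/STATUS 2026-08-21T10:48Z) was not in the tree at the time of writing (v1, p271033); see v1.1 below.
* **v1.1 (gen 8, after p24's `SpecialUnitarySimple` p292822 landed)** `eq355_scalarTable_su_of_card` — **`G = SU(N)`, `N ≥ 2`,
  with NO Lie-algebra-side hypothesis left**: the simplicity binder is discharged by `SpecialUnitarySimple.isSimple_su`
  ([Hall2015, Prop. 3.38 / (3.17), Prop. 7.31]) and the test element `a ≠ 0` by `SpecialUnitarySimple.exists_ne_zero_su`, both
  from the single printed side condition `1 < Fintype.card n` (`N ≥ 2`); instance form `eq355_scalarTable_su_fact` under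
  `[Fact (1 < Fintype.card n)]`.  What remains are exactly the analytic hypotheses of (3.51)/(3.55) (HONEST SCOPE (2)).
HONEST SCOPE.  (1) Print says «semisimple»; the scalar-centroid step needs «simple» (r20's `B12Schur433` §3 shows it FAILS
for semisimple non-simple `G`), so the theorems are stated for simple `G` — for `SU(N)` the two coincide.  (2) The analytic
hypotheses of `B14Lem280WardLie` (`𝐄` `C³` at `1`, gauge invariance (4.7) near `1`, the representation `ρ` with
`ρ[a, b] = [ρa, ρb]`, the window/affine-coordinate data of (3.51)) are untouched and carried verbatim.  (3) The commutator Lie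
ring on `Matrix n n ℂ` (Mathlib's non-instance `LieRing.ofAssociativeRing`, enabled file-locally in `CompactKillingForm`) is
not re-enabled here: it is carried inside the type of `su n` and found by unification.  Theorems only; no `def`, no new `Prop`, no new named fact; zero `sorry`.
-/

noncomputable section

namespace Literature.MathematicalPhysics.QuantumFieldTheory.Balaban1983to89.B14.Lem280WardSuN

open Finset
open _root_.Filter _root_.Topology
open NormedSpace (exp)
open Literature.MathematicalPhysics.QuantumFieldTheory.Balaban1983to89
open Literature.MathematicalPhysics.QuantumFieldTheory.Balaban1983to89.B14.Eq356FieldStrength (moment2)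

/-! ## §1 Compact simple `G`: negative-definite Killing form -/

section CompactSimple

variable {𝔄 : Type*} [NormedRing 𝔄] [NormedAlgebra ℝ 𝔄] [CompleteSpace 𝔄] {d : ℕ} {T : Type*} [Fintype T]
  [AddCommGroup T] [DecidableEq T] {V : Type*} [NormedAddCommGroup V] [NormedSpace ℝ V]
  {𝔤 : Type*} [LieRing 𝔤] [LieAlgebra ℝ 𝔤] [FiniteDimensional ℝ 𝔤]

omit [FiniteDimensional ℝ 𝔤] in
/-- A negative-definite Killing form is non-degenerate: `𝔤` is Killing in Mathlib's sense (`killingCompl ⊤ = ⊥`).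
[cite: BrockerTomDieck1985, V (5.13); Hall2015, Exercise 7.6 (b)] -/
theorem isKilling_of_killing_neg (hdef : ∀ x : 𝔤, x ≠ 0 → killingForm ℝ 𝔤 x x < 0) : LieAlgebra.IsKilling ℝ 𝔤 := by
  refine ⟨?_⟩
  rw [eq_bot_iff]
  intro x hx
  rw [LieIdeal.mem_killingCompl] at hx
  rw [LieSubmodule.mem_bot]
  by_contra hx0
  exact (hdef x hx0).ne (hx x (LieSubmodule.mem_top x))

/-- **(3.51) and (3.55) for the scalar table of a nonabelian gauge-invariant real functional, COMPACT SIMPLE `G`** —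
`B14Lem280WardLie.eq355_scalarTable_of_gaugeInvariance` with `β := κ` the Killing form of a SIMPLE real `𝔤` with `κ(x, x) < 0`
for `x ≠ 0`: semisimplicity (Mathlib, from `IsSimple`), invariance and non-degeneracy of `κ`, the scalar centroid (print's
*"𝐄_ab is proportional to the identity matrix"*, `B12Schur433.exists_eq_smul_of_centroid_of_killing_neg`) and the test
elements (`a = l ≠ 0`) are DISCHARGED; the analytic hypotheses are verbatim.
[cite: Balaban1988Convergent, (3.51)–(3.55) pp.280–281; Balaban1987RG1, p.251, (4.33) p.289] -/
theorem eq355_scalarTable_of_killing_neg [LieAlgebra.IsSimple ℝ 𝔤]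
    (hdef : ∀ x : 𝔤, x ≠ 0 → killingForm ℝ 𝔤 x x < 0) (eV : V ≃ₗ[ℝ] 𝔤)
    {ℰ : (Fin d → T → 𝔄) → ℝ} (e : Fin d → T) (ρ : V →L[ℝ] 𝔄)
    (hρ : ∀ a b : V, ρ (eV.symm ⁅eV a, eV b⁆) = ρ a * ρ b - ρ b * ρ a) (hℰ : ContDiffAt ℝ 3 ℰ 1)
    (h47 : ∀ lam : T → V, ∀ᶠ W in 𝓝 (1 : Fin d → T → 𝔄), ∀ᶠ t in 𝓝 (0 : ℝ),
      ℰ (fun ν x => exp (t • ρ (lam x)) * W ν x * exp (-(t • ρ (lam (x + e ν))))) = ℰ W)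
    {a : 𝔤} (ha : a ≠ 0)
    (W : Finset T) (coord : T → Fin d → ℝ) (z : T) {ξ : ℝ} (hξ : ξ ≠ 0)
    (hco : ∀ x ∈ W, ∀ μ κ, coord (x + e μ) κ = coord x κ + if κ = μ then ξ else 0) :
    ∃ E : Fin d → T → Fin d → T → ℝ,
      (∀ u v : Fin d → T → V, fderiv ℝ (fderiv ℝ (fun B : Fin d → T → V => ℰ (fun ν x => exp (ρ (B ν x))))) 0 u v =
        ∑ μ, ∑ x, ∑ ν, ∑ y, killingForm ℝ 𝔤 (eV (u μ x)) (eV (v ν y)) * E μ x ν y) ∧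
      ((∀ μ ν x y, x ∉ W → E μ x ν y = 0) →
        (∀ ν y μ κ, ∑ x ∈ W, E μ x ν y * (coord x κ - coord z κ)
            = -∑ x ∈ W, E κ x ν y * (coord x μ - coord z μ)) ∧
        (∀ μ ν κ τ, moment2 (W ×ˢ W) (fun μ ν x y => E μ x ν y) coord z μ ν κ τ
            = -moment2 (W ×ˢ W) (fun μ ν x y => E μ x ν y) coord z κ ν μ τ)) ∧
      ((∀ μ ν x y, y ∉ W → E μ x ν y = 0) →
        (∀ μ ν κ τ, moment2 (W ×ˢ W) (fun μ ν x y => E μ x ν y) coord z μ ν κ τ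
            = -moment2 (W ×ˢ W) (fun μ ν x y => E μ x ν y) coord z μ τ κ ν)) :=
  haveI := isKilling_of_killing_neg hdef
  Lem280WardLie.eq355_scalarTable_of_gaugeInvariance eV e ρ hρ hℰ h47 (killingForm ℝ 𝔤)
    (LieModule.traceForm_lieInvariant ℝ 𝔤 𝔤) (LieAlgebra.IsKilling.killingForm_nondegenerate ℝ 𝔤)
    (B12Schur433.exists_eq_smul_of_centroid_of_killing_neg hdef) (hdef a ha).ne (hdef a ha).ne W coord z hξ hco

end CompactSimple

/-! ## §2 `G = SU(N)` -/

section SuN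

open Literature.Algebra.Lie.CompactKillingForm

variable {𝔄 : Type*} [NormedRing 𝔄] [NormedAlgebra ℝ 𝔄] [CompleteSpace 𝔄] {d : ℕ} {T : Type*} [Fintype T]
  [AddCommGroup T] [DecidableEq T] {V : Type*} [NormedAddCommGroup V] [NormedSpace ℝ V]
  (n : Type*) [Fintype n] [DecidableEq n]

/-- **(3.51) and (3.55) for the scalar table, `G = SU(N)`** — `eq355_scalarTable_of_killing_neg` at `𝔤 := 𝔰𝔲(n)` (p24's
`CompactKillingForm.su n`, negative-definite Killing form `killingForm_su_apply_self_neg`); the simplicity of `𝔰𝔲(n)`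
(`|n| ≥ 2`) is the typeclass hypothesis `[LieAlgebra.IsSimple ℝ (su n)]` (p24's instance pending at the time of writing).
[cite: Balaban1988Convergent, (3.51)–(3.55) pp.280–281; Balaban1987RG1, p.251 ("for example G ⊂ U(N)")] -/
theorem eq355_scalarTable_su [LieAlgebra.IsSimple ℝ (su n)] (eV : V ≃ₗ[ℝ] su n)
    {ℰ : (Fin d → T → 𝔄) → ℝ} (e : Fin d → T) (ρ : V →L[ℝ] 𝔄)
    (hρ : ∀ a b : V, ρ (eV.symm ⁅eV a, eV b⁆) = ρ a * ρ b - ρ b * ρ a) (hℰ : ContDiffAt ℝ 3 ℰ 1)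
    (h47 : ∀ lam : T → V, ∀ᶠ W in 𝓝 (1 : Fin d → T → 𝔄), ∀ᶠ t in 𝓝 (0 : ℝ),
      ℰ (fun ν x => exp (t • ρ (lam x)) * W ν x * exp (-(t • ρ (lam (x + e ν))))) = ℰ W)
    {a : su n} (ha : a ≠ 0)
    (W : Finset T) (coord : T → Fin d → ℝ) (z : T) {ξ : ℝ} (hξ : ξ ≠ 0)
    (hco : ∀ x ∈ W, ∀ μ κ, coord (x + e μ) κ = coord x κ + if κ = μ then ξ else 0) :
    ∃ E : Fin d → T → Fin d → T → ℝ,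
      (∀ u v : Fin d → T → V, fderiv ℝ (fderiv ℝ (fun B : Fin d → T → V => ℰ (fun ν x => exp (ρ (B ν x))))) 0 u v =
        ∑ μ, ∑ x, ∑ ν, ∑ y, killingForm ℝ (su n) (eV (u μ x)) (eV (v ν y)) * E μ x ν y) ∧
      ((∀ μ ν x y, x ∉ W → E μ x ν y = 0) →
        (∀ ν y μ κ, ∑ x ∈ W, E μ x ν y * (coord x κ - coord z κ)
            = -∑ x ∈ W, E κ x ν y * (coord x μ - coord z μ)) ∧
        (∀ μ ν κ τ, moment2 (W ×ˢ W) (fun μ ν x y => E μ x ν y) coord z μ ν κ τ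
            = -moment2 (W ×ˢ W) (fun μ ν x y => E μ x ν y) coord z κ ν μ τ)) ∧
      ((∀ μ ν x y, y ∉ W → E μ x ν y = 0) →
        (∀ μ ν κ τ, moment2 (W ×ˢ W) (fun μ ν x y => E μ x ν y) coord z μ ν κ τ
            = -moment2 (W ×ˢ W) (fun μ ν x y => E μ x ν y) coord z μ τ κ ν)) :=
  eq355_scalarTable_of_killing_neg (fun _ hX => killingForm_su_apply_self_neg hX) eV e ρ hρ hℰ h47 ha W coord z hξ hco

end SuN

/-! ## §3 `G = SU(N)`, `N ≥ 2`: the simplicity binder and the test element discharged (v1.1, gen 8) -/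

section SuNCard

open Literature.Algebra.Lie.CompactKillingForm
open Literature.Algebra.Lie.SpecialUnitarySimple (isSimple_su exists_ne_zero_su)

variable {𝔄 : Type*} [NormedRing 𝔄] [NormedAlgebra ℝ 𝔄] [CompleteSpace 𝔄] {d : ℕ} {T : Type*} [Fintype T]
  [AddCommGroup T] [DecidableEq T] {V : Type*} [NormedAddCommGroup V] [NormedSpace ℝ V]
  (n : Type*) [Fintype n] [DecidableEq n]

/-- **(3.51) and (3.55) for the scalar table, `G = SU(N)` with `N ≥ 2` — no Lie-algebra-side hypothesis left.**
`eq355_scalarTable_su` with the typeclass binder `[LieAlgebra.IsSimple ℝ (su n)]` DISCHARGED by p24's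
`SpecialUnitarySimple.isSimple_su` (`𝔰𝔲(n)` is simple for `|n| ≥ 2`, [Hall2015, Prop. 3.38, Prop. 7.31]) and the test element
`a ≠ 0` by `SpecialUnitarySimple.exists_ne_zero_su`, from the one side condition `hN : 1 < Fintype.card n` (print's example
*"G ⊂ U(N)"*, [I] p. 251; `N ≥ 2` is where `SU(N)` is non-abelian and simple).  The analytic hypotheses (`hρ`, `hℰ`, `h47`,
window/coordinate data) are verbatim those of `B14Lem280WardLie.eq355_scalarTable_of_gaugeInvariance`.
[cite: Balaban1988Convergent, (3.51)–(3.55) pp.280–281; Balaban1987RG1, p.251 ("for example G ⊂ U(N)"), (4.33) p.289] -/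
theorem eq355_scalarTable_su_of_card (hN : 1 < Fintype.card n) (eV : V ≃ₗ[ℝ] su n)
    {ℰ : (Fin d → T → 𝔄) → ℝ} (e : Fin d → T) (ρ : V →L[ℝ] 𝔄)
    (hρ : ∀ a b : V, ρ (eV.symm ⁅eV a, eV b⁆) = ρ a * ρ b - ρ b * ρ a) (hℰ : ContDiffAt ℝ 3 ℰ 1)
    (h47 : ∀ lam : T → V, ∀ᶠ W in 𝓝 (1 : Fin d → T → 𝔄), ∀ᶠ t in 𝓝 (0 : ℝ),
      ℰ (fun ν x => exp (t • ρ (lam x)) * W ν x * exp (-(t • ρ (lam (x + e ν))))) = ℰ W)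
    (W : Finset T) (coord : T → Fin d → ℝ) (z : T) {ξ : ℝ} (hξ : ξ ≠ 0)
    (hco : ∀ x ∈ W, ∀ μ κ, coord (x + e μ) κ = coord x κ + if κ = μ then ξ else 0) :
    ∃ E : Fin d → T → Fin d → T → ℝ,
      (∀ u v : Fin d → T → V, fderiv ℝ (fderiv ℝ (fun B : Fin d → T → V => ℰ (fun ν x => exp (ρ (B ν x))))) 0 u v =
        ∑ μ, ∑ x, ∑ ν, ∑ y, killingForm ℝ (su n) (eV (u μ x)) (eV (v ν y)) * E μ x ν y) ∧
      ((∀ μ ν x y, x ∉ W → E μ x ν y = 0) →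
        (∀ ν y μ κ, ∑ x ∈ W, E μ x ν y * (coord x κ - coord z κ)
            = -∑ x ∈ W, E κ x ν y * (coord x μ - coord z μ)) ∧
        (∀ μ ν κ τ, moment2 (W ×ˢ W) (fun μ ν x y => E μ x ν y) coord z μ ν κ τ
            = -moment2 (W ×ˢ W) (fun μ ν x y => E μ x ν y) coord z κ ν μ τ)) ∧
      ((∀ μ ν x y, y ∉ W → E μ x ν y = 0) →
        (∀ μ ν κ τ, moment2 (W ×ˢ W) (fun μ ν x y => E μ x ν y) coord z μ ν κ τ
            = -moment2 (W ×ˢ W) (fun μ ν x y => E μ x ν y) coord z μ τ κ ν)) := by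
  obtain ⟨a, ha⟩ := exists_ne_zero_su (n := n) hN
  haveI : LieAlgebra.IsSimple ℝ (su n) := isSimple_su n hN
  exact eq355_scalarTable_su n eV e ρ hρ hℰ h47 ha W coord z hξ hco

/-- Instance form of `eq355_scalarTable_su_of_card`: under `[Fact (1 < Fintype.card n)]` (p24's `instIsSimpleSu` idiom).
[cite: Balaban1988Convergent, (3.51)–(3.55) pp.280–281; Balaban1987RG1, p.251] -/
theorem eq355_scalarTable_su_fact [hN : Fact (1 < Fintype.card n)] (eV : V ≃ₗ[ℝ] su n)
    {ℰ : (Fin d → T → 𝔄) → ℝ} (e : Fin d → T) (ρ : V →L[ℝ] 𝔄)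
    (hρ : ∀ a b : V, ρ (eV.symm ⁅eV a, eV b⁆) = ρ a * ρ b - ρ b * ρ a) (hℰ : ContDiffAt ℝ 3 ℰ 1)
    (h47 : ∀ lam : T → V, ∀ᶠ W in 𝓝 (1 : Fin d → T → 𝔄), ∀ᶠ t in 𝓝 (0 : ℝ),
      ℰ (fun ν x => exp (t • ρ (lam x)) * W ν x * exp (-(t • ρ (lam (x + e ν))))) = ℰ W)
    (W : Finset T) (coord : T → Fin d → ℝ) (z : T) {ξ : ℝ} (hξ : ξ ≠ 0)
    (hco : ∀ x ∈ W, ∀ μ κ, coord (x + e μ) κ = coord x κ + if κ = μ then ξ else 0) :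
    ∃ E : Fin d → T → Fin d → T → ℝ,
      (∀ u v : Fin d → T → V, fderiv ℝ (fderiv ℝ (fun B : Fin d → T → V => ℰ (fun ν x => exp (ρ (B ν x))))) 0 u v =
        ∑ μ, ∑ x, ∑ ν, ∑ y, killingForm ℝ (su n) (eV (u μ x)) (eV (v ν y)) * E μ x ν y) ∧
      ((∀ μ ν x y, x ∉ W → E μ x ν y = 0) →
        (∀ ν y μ κ, ∑ x ∈ W, E μ x ν y * (coord x κ - coord z κ)
            = -∑ x ∈ W, E κ x ν y * (coord x μ - coord z μ)) ∧
        (∀ μ ν κ τ, moment2 (W ×ˢ W) (fun μ ν x y => E μ x ν y) coord z μ ν κ τ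
            = -moment2 (W ×ˢ W) (fun μ ν x y => E μ x ν y) coord z κ ν μ τ)) ∧
      ((∀ μ ν x y, y ∉ W → E μ x ν y = 0) →
        (∀ μ ν κ τ, moment2 (W ×ˢ W) (fun μ ν x y => E μ x ν y) coord z μ ν κ τ
            = -moment2 (W ×ˢ W) (fun μ ν x y => E μ x ν y) coord z μ τ κ ν)) :=
  eq355_scalarTable_su_of_card n hN.out eV e ρ hρ hℰ h47 W coord z hξ hco

end SuNCard

end Literature.MathematicalPhysics.QuantumFieldTheory.Balaban1983to89.B14.Lem280WardSuN
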